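import Summits.CriticalPhenomena.CardyFormulaZ2.Theses.CardyIKTransport
import Summits.CriticalPhenomena.CardyFormulaZ2.Theorems.CardyIKTransportCornerLineDescentLine
import Literature.Probability.Percolation.RussoFormula

/-!
# Stub `stub_Russo` of line `symmetric-seed-second-order`, crux `CornerLineDescent`
# (`CardyIKTransport`, stmt-CriticalPhenomena-10964): the non-monotone Margulis–Russo formula
# in mean-value form

For the corner-line gauge `gaugeMeasure p` (five independent Bernoulli factors, only the third —
the syndromes, density `p` — depending on `p`) and the crude crossing event
`A = crossingEvent R δ`, which by the hypothesis `CrossingEventLocalAt R δ` is determined by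
finitely many bits `K₁, …, K₅` of the five factors, we prove `RussoLipschitzOn R δ p₁ p₂ M` for
`0 ≤ p₁ ≤ p₂ ≤ 1`: if `Σ_f |I_f(p)| ≤ M` on `[p₁, p₂]` then
`|P_{p₂}(A) − P_{p₁}(A)| ≤ M (p₂ − p₁)`.

Proof (Russo 1981, §4, Lemma 3, run for a NON-monotone event, i.e. with the signed bracket
`1[S ∪ {f} ∈ A] − 1[S ∈ A]` in place of the pivotality indicator; Grimmett, *Percolation*,
Thm. 2.25):
* `exists_finite_marginal`: a locally determined event is the disjoint finite union of the
  product cylinders `[T₁]_{K₁} × ⋯ × [T₅]_{K₅}` meeting it, so by `Measure.prod_prod` and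
  `Russo.setBernoulli_real_localCylinder` its probability is
  `Σ_{r, S ⊆ K₃} 1[rep(S, r) ∈ A] a_r W_S(p)` with
  `W_S(p) = ∏_{i ∈ K₃} weight(S, i, p) = p^{|S|} (1 − p)^{|K₃ ∖ S|}` and `p`-free coefficients
  `a_r` (the four fair factors); the forced events `force f b ⁻¹' A` are determined by the same
  bits, forcing acts on representatives by `S ↦ insert f S` / `S ↦ S.erase f`, and faces
  `f ∉ K₃` have `force f b ⁻¹' A = A` (so the `finsum` `influenceSum` is a finite sum);
* `sum_pair_weight` (the pairing `S ↔ insert f S`): `Σ_{f ∈ K₃} I_f(p)` is the derivative of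
  the polynomial (product rule, `hasDerivAt_prod_weight`);
* the mean value inequality `norm_image_sub_le_of_norm_deriv_le_segment'` on `[p₁, p₂]`.
-/

noncomputable section

namespace Summit.CriticalPhenomena.CardyFormulaZ2.Theorems.CornerLineDescent.SymmetricSeed

open scoped BigOperators Topology Classical MeasureTheory ProbabilityTheory ENNReal NNReal
open Filter Set Function MeasureTheory
open Literature.Probability.Percolation (sitePercolation bondPercolation half BondConfig
  embDomainCrossing rectangle localCylinder measurableSet_localCylinder)
open Literature.Probability.Percolation.Russo (weight dweight hasDerivAt_weight
  weight_insert_of_ne setBernoulli_real_localCylinder)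
open Literature.Probability.LatticeModels
open Literature.Probability.RandomPlanarGeometry

/-! ## Generic helpers: finite cylinders, the pairing `S ↔ insert e S`, the product rule -/

section Generic

variable {ι : Type*}

/-- A configuration lies in the `K`-cylinder of `T ⊆ K` iff its trace on `K` is `T`.
[folklore] -/
theorem mem_localCylinder_coe_iff {K T : Finset ι} (hT : T ⊆ K) (ω : Set ι) :
    ω ∈ localCylinder (↑K : Set ι) ↑T ↔ K.filter (· ∈ ω) = T := by
  constructor
  · intro h
    ext i
    simp only [Finset.mem_filter]
    exact ⟨fun hi => (h i hi.1).1 hi.2, fun hi => ⟨hT hi, (h i (hT hi)).2 hi⟩⟩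
  · rintro rfl i hi
    simp [Finset.mem_coe.1 hi]

/-- Sets agreeing pointwise on a finite window have the same trace on it. [folklore] -/
theorem inter_coe_eq_of_forall {s t : Set ι} {K : Finset ι}
    (h : ∀ i ∈ K, (i ∈ s ↔ i ∈ t)) : s ∩ ↑K = t ∩ ↑K := by
  ext i
  simp only [mem_inter_iff, Finset.mem_coe]
  exact ⟨fun hi => ⟨(h i hi.2).1 hi.1, hi.2⟩, fun hi => ⟨(h i hi.2).2 hi.1, hi.2⟩⟩

/-- Abstract cylinder decomposition: if finitely many measurable, mutually exclusive,
exhaustive cells `cyl x` are given and membership in `B` is constant on each cell (read off at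
the representative `rep x`), then `μ(B) = Σ_x 1[rep x ∈ B] μ(cyl x)`. [folklore] -/
theorem measureReal_eq_sum_ite {X κ : Type*} [MeasurableSpace X] (μ : Measure X)
    [IsFiniteMeasure μ] (P : Finset κ) (cyl : κ → Set X) (rep : κ → X) (B : Set X)
    (hm : ∀ x ∈ P, MeasurableSet (cyl x)) (hcov : ∀ ω, ∃ x ∈ P, ω ∈ cyl x)
    (hdj : ∀ x ∈ P, ∀ y ∈ P, ∀ ω, ω ∈ cyl x → ω ∈ cyl y → x = y)
    (hB : ∀ x ∈ P, ∀ ω ∈ cyl x, (ω ∈ B ↔ rep x ∈ B)) :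
    μ.real B = ∑ x ∈ P, if rep x ∈ B then μ.real (cyl x) else 0 := by
  have hBU : B = ⋃ x ∈ P.filter (fun x => rep x ∈ B), cyl x := by
    ext ω
    simp only [mem_iUnion, Finset.mem_filter, exists_prop]
    constructor
    · intro hω
      obtain ⟨x, hx, hωx⟩ := hcov ω
      exact ⟨x, ⟨hx, (hB x hx ω hωx).1 hω⟩, hωx⟩
    · rintro ⟨x, ⟨hx, hxB⟩, hωx⟩
      exact (hB x hx ω hωx).2 hxB
  conv_lhs => rw [hBU]
  rw [measureReal_biUnion_finset, Finset.sum_filter]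
  · intro x hx y hy hxy
    simp only [Finset.coe_filter, mem_setOf_eq] at hx hy
    exact disjoint_left.2 fun ω hωx hωy => hxy (hdj x hx.1 y hy.1 ω hωx hωy)
  · intro x hx
    exact hm x (Finset.mem_filter.1 hx).1

variable [DecidableEq ι]

/-- The pairing `S ↔ insert e S` of the subsets of `K ∋ e`. [folklore] -/
theorem sum_powerset_pair {K : Finset ι} {e : ι} (he : e ∈ K) (F : Finset ι → ℝ) :
    ∑ S ∈ K.powerset, F S = ∑ S ∈ (K.erase e).powerset, (F S + F (insert e S)) := by
  -- adapted from `Literature.Probability.Percolation.Russo.sum_dweight_eq_measureReal_pivotal`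
  have hpow : K.powerset = (K.erase e).powerset ∪ (K.erase e).powerset.image (insert e) := by
    rw [← Finset.powerset_insert, Finset.insert_erase he]
  have hdisj : Disjoint (K.erase e).powerset ((K.erase e).powerset.image (insert e)) := by
    rw [Finset.disjoint_left]
    intro S hS hS'
    obtain ⟨T, -, rfl⟩ := Finset.mem_image.1 hS'
    have := Finset.mem_powerset.1 hS (Finset.mem_insert_self e T)
    simp at this
  have hinj : Set.InjOn (insert e) (↑(K.erase e).powerset : Set (Finset ι)) := by
    intro S hS T hT hST
    have heS : e ∉ S := fun h => by simpa using Finset.mem_powerset.1 hS h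
    have heT : e ∉ T := fun h => by simpa using Finset.mem_powerset.1 hT h
    rw [← Finset.erase_insert heS, ← Finset.erase_insert heT, hST]
  rw [hpow, Finset.sum_union hdisj, Finset.sum_image hinj, ← Finset.sum_add_distrib]

/-- Product rule for the cylinder weight `W_S(q) = ∏_{i ∈ K} weight(S, i, q)`. [folklore] -/
theorem hasDerivAt_prod_weight (K : Finset ι) (S : Set ι) (q : ℝ) :
    HasDerivAt (fun q => ∏ i ∈ K, weight univ S i q)
      (∑ e ∈ K, (∏ j ∈ K.erase e, weight univ S j q) * dweight univ S e) q := by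
  have := HasDerivAt.fun_finsetProd (u := K) (x := q) (fun i _ => hasDerivAt_weight univ S i q)
  simpa [smul_eq_mul] using this

/-- Russo's pairing with the SIGNED bracket (no monotonicity): for `e ∈ K` and any `g`,
`Σ_{S ⊆ K} (g(S ∪ {e}) − g(S ∖ {e})) W_S(q) = Σ_{S ⊆ K} g(S) ∂_e W_S(q)`, where `∂_e W_S` is
the `e`-th term of the product rule. [folklore] -/
theorem sum_pair_weight {K : Finset ι} {e : ι} (he : e ∈ K) (g : Finset ι → ℝ) (q : ℝ) :
    ∑ S ∈ K.powerset, (g (insert e S) - g (S.erase e)) * ∏ i ∈ K, weight univ (↑S : Set ι) i q =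
      ∑ S ∈ K.powerset, g S * ((∏ j ∈ K.erase e, weight univ (↑S : Set ι) j q) *
        dweight univ (↑S : Set ι) e) := by
  rw [sum_powerset_pair he, sum_powerset_pair he]
  refine Finset.sum_congr rfl fun S hS => ?_
  have heS : e ∉ S := fun h => by simpa using Finset.mem_powerset.1 hS h
  have heS' : e ∉ (↑S : Set ι) := by simpa using heS
  have hw : ∀ T : Finset ι, ∏ i ∈ K, weight univ (↑T : Set ι) i q =
      weight univ (↑T : Set ι) e q * ∏ i ∈ K.erase e, weight univ (↑T : Set ι) i q :=
    fun T => (Finset.mul_prod_erase K _ he).symm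
  have hwi : ∏ j ∈ K.erase e, weight univ (↑(insert e S) : Set ι) j q =
      ∏ j ∈ K.erase e, weight univ (↑S : Set ι) j q := by
    refine Finset.prod_congr rfl fun j hj => ?_
    rw [Finset.coe_insert]
    exact weight_insert_of_ne univ _ (Finset.ne_of_mem_erase hj) _
  have h1 : weight univ (↑S : Set ι) e q = 1 - q := by simp [weight, heS']
  have h2 : weight univ (↑(insert e S) : Set ι) e q = q := by simp [weight]
  have h3 : dweight univ (↑S : Set ι) e = -1 := by simp [dweight, heS']
  have h4 : dweight univ (↑(insert e S) : Set ι) e = 1 := by simp [dweight]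
  rw [Finset.erase_eq_of_notMem heS, Finset.insert_idem, Finset.erase_insert heS, hw S,
    hw (insert e S), hwi, h1, h2, h3, h4]
  ring

end Generic

/-! ## The gauge: locality, product cylinders, the polynomial -/

/-- The gauge is a probability measure (product of five Bernoulli product measures).
[folklore] -/
theorem isProbabilityMeasure_gaugeMeasure (p : ℝ) : IsProbabilityMeasure (gaugeMeasure p) := by
  unfold gaugeMeasure; infer_instance

/-- Forcing the syndrome at `f` ON sends the representative configuration of the pattern
`(S, r)` to that of `(insert f S, r)`. [folklore] -/
theorem force_true_rep (f : Site 2) (S : Finset (Site 2))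
    (r : Finset ℤ × Finset ℤ × Finset (Site 2) × Finset (Site 2)) :
    force f true ((↑r.1, ↑r.2.1, ↑S, ↑r.2.2.1, ↑r.2.2.2) : Bits) =
      ((↑r.1, ↑r.2.1, ↑(insert f S), ↑r.2.2.1, ↑r.2.2.2) : Bits) := by
  simp [force]

/-- Forcing the syndrome at `f` OFF sends the representative configuration of the pattern
`(S, r)` to that of `(S.erase f, r)`. [folklore] -/
theorem force_false_rep (f : Site 2) (S : Finset (Site 2))
    (r : Finset ℤ × Finset ℤ × Finset (Site 2) × Finset (Site 2)) :
    force f false ((↑r.1, ↑r.2.1, ↑S, ↑r.2.2.1, ↑r.2.2.2) : Bits) =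
      ((↑r.1, ↑r.2.1, ↑(S.erase f), ↑r.2.2.1, ↑r.2.2.2) : Bits) := by
  simp [force]

/-- Finite-dimensional marginal of the gauge.  If the crude crossing event `A` is determined by
finite windows `K₁, …, K₅` of the five factors, then for `q ∈ [0, 1]` the probabilities of `A`
and of every forced event `force f b ⁻¹' A` are
`Σ_{r, S ⊆ K₃} 1[(force f b) rep(S, r) ∈ A] a_r ∏_{i ∈ K₃} weight(S, i, q)`, with `q`-free
coefficients `a_r` (the four fair factors of the product cylinder) and `rep(S, r)` the
representative configuration of the pattern; and faces `f ∉ K₃` do not move `A`. [folklore] -/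
theorem exists_finite_marginal (R : ConformalRectangle) (δ : ℝ)
    (hRδ : CrossingEventLocalAt R δ) :
    ∃ (K₃ : Finset (Site 2)) (P : Finset (Finset ℤ × Finset ℤ × Finset (Site 2) × Finset (Site 2)))
      (a : Finset ℤ × Finset ℤ × Finset (Site 2) × Finset (Site 2) → ℝ),
      (∀ q ∈ Icc (0:ℝ) 1, (gaugeMeasure q).real (crossingEvent R δ) =
        ∑ r ∈ P, ∑ S ∈ K₃.powerset,
          (if ((↑r.1, ↑r.2.1, ↑S, ↑r.2.2.1, ↑r.2.2.2) : Bits) ∈ crossingEvent R δ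
            then a r else 0) * ∏ i ∈ K₃, weight univ (↑S : Set (Site 2)) i q) ∧
      (∀ (f : Site 2) (b : Bool), ∀ q ∈ Icc (0:ℝ) 1,
        (gaugeMeasure q).real (force f b ⁻¹' crossingEvent R δ) =
          ∑ r ∈ P, ∑ S ∈ K₃.powerset,
            (if force f b ((↑r.1, ↑r.2.1, ↑S, ↑r.2.2.1, ↑r.2.2.2) : Bits) ∈ crossingEvent R δ
              then a r else 0) * ∏ i ∈ K₃, weight univ (↑S : Set (Site 2)) i q) ∧
      (∀ f ∉ K₃, ∀ b : Bool, force f b ⁻¹' crossingEvent R δ = crossingEvent R δ) := by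
  obtain ⟨K₁, K₂, K₃, K₄, K₅, hK⟩ := hRδ
  -- pointwise locality `L B` of an event `B` with respect to the windows
  obtain ⟨L, hL⟩ : ∃ L : Set Bits → Prop, ∀ B, L B ↔ ∀ ω ω' : Bits,
      (∀ i ∈ K₁, i ∈ ω.1 ↔ i ∈ ω'.1) → (∀ i ∈ K₂, i ∈ ω.2.1 ↔ i ∈ ω'.2.1) →
        (∀ i ∈ K₃, i ∈ ω.2.2.1 ↔ i ∈ ω'.2.2.1) →
          (∀ i ∈ K₄, i ∈ ω.2.2.2.1 ↔ i ∈ ω'.2.2.2.1) →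
            (∀ i ∈ K₅, i ∈ ω.2.2.2.2 ↔ i ∈ ω'.2.2.2.2) → (ω ∈ B ↔ ω' ∈ B) :=
    ⟨_, fun _ => Iff.rfl⟩
  have hA : L (crossingEvent R δ) := (hL _).2 fun ω ω' h1 h2 h3 h4 h5 =>
    hK ω ω' (inter_coe_eq_of_forall h1) (inter_coe_eq_of_forall h2) (inter_coe_eq_of_forall h3)
      (inter_coe_eq_of_forall h4) (inter_coe_eq_of_forall h5)
  have hLf : ∀ (f : Site 2) (b : Bool) (B : Set Bits), L B → L (force f b ⁻¹' B) := by
    intro f b B hB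
    refine (hL _).2 fun ω ω' h1 h2 h3 h4 h5 => ?_
    simp only [mem_preimage]
    refine (hL B).1 hB _ _ h1 h2 (fun i hi => ?_) h4 h5
    cases b <;> simp [force, h3 i hi]
  have hfix : ∀ f ∉ K₃, ∀ b : Bool, force f b ⁻¹' crossingEvent R δ = crossingEvent R δ := by
    intro f hf b
    ext ω
    rw [mem_preimage]
    refine (hL _).1 hA _ _ (fun _ _ => Iff.rfl) (fun _ _ => Iff.rfl) (fun i hi => ?_)
      (fun _ _ => Iff.rfl) (fun _ _ => Iff.rfl)
    have hif : i ≠ f := fun h => hf (h ▸ hi)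
    cases b <;> simp [force, hif]
  -- the `q`-free patterns and coefficients
  obtain ⟨P, hP⟩ : ∃ P : Finset (Finset ℤ × Finset ℤ × Finset (Site 2) × Finset (Site 2)),
      P = K₁.powerset ×ˢ K₂.powerset ×ˢ K₄.powerset ×ˢ K₅.powerset := ⟨_, rfl⟩
  obtain ⟨a, ha⟩ : ∃ a : Finset ℤ × Finset ℤ × Finset (Site 2) × Finset (Site 2) → ℝ, ∀ r,
      a r = (sitePercolation ℤ half).real (localCylinder ↑K₁ ↑r.1) *
        ((sitePercolation ℤ half).real (localCylinder ↑K₂ ↑r.2.1) *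
          ((sitePercolation (Site 2) half).real (localCylinder ↑K₄ ↑r.2.2.1) *
            (sitePercolation (Site 2) half).real (localCylinder ↑K₅ ↑r.2.2.2))) :=
    ⟨_, fun _ => rfl⟩
  -- the finite-dimensional marginal of a local event
  have hPa : ∀ B, L B → ∀ q ∈ Icc (0:ℝ) 1, (gaugeMeasure q).real B =
      ∑ r ∈ P, ∑ S ∈ K₃.powerset,
        (if ((↑r.1, ↑r.2.1, ↑S, ↑r.2.2.1, ↑r.2.2.2) : Bits) ∈ B then a r else 0) *
          ∏ i ∈ K₃, weight univ (↑S : Set (Site 2)) i q := by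
    intro B hB q hq
    haveI := isProbabilityMeasure_gaugeMeasure q
    have key := measureReal_eq_sum_ite (gaugeMeasure q) (P ×ˢ K₃.powerset)
      (fun x : (Finset ℤ × Finset ℤ × Finset (Site 2) × Finset (Site 2)) × Finset (Site 2) =>
        localCylinder (↑K₁ : Set ℤ) ↑x.1.1 ×ˢ (localCylinder (↑K₂ : Set ℤ) ↑x.1.2.1 ×ˢ
          (localCylinder (↑K₃ : Set (Site 2)) ↑x.2 ×ˢ
            (localCylinder (↑K₄ : Set (Site 2)) ↑x.1.2.2.1 ×ˢ
              localCylinder (↑K₅ : Set (Site 2)) ↑x.1.2.2.2))))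
      (fun x => ((↑x.1.1, ↑x.1.2.1, ↑x.2, ↑x.1.2.2.1, ↑x.1.2.2.2) : Bits)) B ?_ ?_ ?_ ?_
    · rw [key, Finset.sum_product]
      refine Finset.sum_congr rfl fun r _ => Finset.sum_congr rfl fun S _ => ?_
      dsimp only
      split_ifs
      · simp only [gaugeMeasure, measureReal_prod_prod, Set.projIcc_of_mem zero_le_one hq]
        rw [ha, show (sitePercolation (Site 2) ⟨q, hq⟩).real (localCylinder ↑K₃ ↑S) =
            ∏ i ∈ K₃, weight univ (↑S : Set (Site 2)) i q from
          setBernoulli_real_localCylinder univ ⟨q, hq⟩ K₃ _]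
        ring
      · simp
    · intro x _
      exact (measurableSet_localCylinder K₁.finite_toSet.countable _).prod
        ((measurableSet_localCylinder K₂.finite_toSet.countable _).prod
          ((measurableSet_localCylinder K₃.finite_toSet.countable _).prod
            ((measurableSet_localCylinder K₄.finite_toSet.countable _).prod
              (measurableSet_localCylinder K₅.finite_toSet.countable _))))
    · intro ω
      refine ⟨((K₁.filter (· ∈ ω.1), K₂.filter (· ∈ ω.2.1), K₄.filter (· ∈ ω.2.2.2.1),
        K₅.filter (· ∈ ω.2.2.2.2)), K₃.filter (· ∈ ω.2.2.1)),
        by simp [hP, Finset.filter_subset], ?_⟩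
      simp only [mem_prod]
      exact ⟨(mem_localCylinder_coe_iff (Finset.filter_subset _ _) _).2 rfl,
        (mem_localCylinder_coe_iff (Finset.filter_subset _ _) _).2 rfl,
        (mem_localCylinder_coe_iff (Finset.filter_subset _ _) _).2 rfl,
        (mem_localCylinder_coe_iff (Finset.filter_subset _ _) _).2 rfl,
        (mem_localCylinder_coe_iff (Finset.filter_subset _ _) _).2 rfl⟩
    · rintro ⟨⟨r₁, r₂, r₄, r₅⟩, S⟩ hx ⟨⟨r₁', r₂', r₄', r₅'⟩, S'⟩ hy ω hωx hωy
      simp only [hP, Finset.mem_product, Finset.mem_powerset] at hx hy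
      simp only [mem_prod, mem_localCylinder_coe_iff hx.1.1, mem_localCylinder_coe_iff hx.1.2.1,
        mem_localCylinder_coe_iff hx.2, mem_localCylinder_coe_iff hx.1.2.2.1,
        mem_localCylinder_coe_iff hx.1.2.2.2] at hωx
      simp only [mem_prod, mem_localCylinder_coe_iff hy.1.1, mem_localCylinder_coe_iff hy.1.2.1,
        mem_localCylinder_coe_iff hy.2, mem_localCylinder_coe_iff hy.1.2.2.1,
        mem_localCylinder_coe_iff hy.1.2.2.2] at hωy
      obtain ⟨h1, h2, h3, h4, h5⟩ := hωx
      obtain ⟨h1', h2', h3', h4', h5'⟩ := hωy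
      subst h1 h2 h3 h4 h5 h1' h2' h3' h4' h5'
      rfl
    · rintro ⟨r, S⟩ - ω hω
      simp only [mem_prod] at hω
      exact (hL B).1 hB ω _ hω.1 hω.2.1 hω.2.2.1 hω.2.2.2.1 hω.2.2.2.2
  refine ⟨K₃, P, a, fun q hq => hPa _ hA q hq, fun f b q hq => ?_, hfix⟩
  rw [hPa _ (hLf f b _ hA) q hq]
  rfl

/-! ## The stub -/

/-- Registered stub `stub_Russo` of crux stmt-CriticalPhenomena-10964 (line
`symmetric-seed-second-order`): the Margulis–Russo formula for the non-monotone product gauge in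
mean-value form — if the crude crossing event is determined by finitely many bits at every
positive mesh, then for `0 ≤ p₁ ≤ p₂ ≤ 1`, `Σ_f |I_f| ≤ M` on `[p₁, p₂]` implies
`|P_{p₂}(A) − P_{p₁}(A)| ≤ M (p₂ − p₁)` (Russo 1981, §4 Lemma 3, with the signed bracket;
Grimmett 1999, Thm. 2.25). [folklore] -/
theorem stub_Russo :
    (∀ (R : ConformalRectangle) (δ : ℝ), 0 < δ → CrossingEventLocalAt R δ) →
      ∀ (R : ConformalRectangle) (δ : ℝ), 0 < δ → ∀ p₁ p₂ M : ℝ, 0 ≤ p₁ → p₁ ≤ p₂ → p₂ ≤ 1 →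
        RussoLipschitzOn R δ p₁ p₂ M := by
  intro hloc R δ hδ p₁ p₂ M hp₁ h₁₂ hp₂ hM
  obtain ⟨K₃, P, a, hP0, hPf, hfix⟩ := exists_finite_marginal R δ (hloc R δ hδ)
  -- the coefficients `c S r = 1[rep(S, r) ∈ A] a_r`, the polynomial `G` and its derivative `G'`
  obtain ⟨c, hc⟩ : ∃ c : Finset (Site 2) → Finset ℤ × Finset ℤ × Finset (Site 2) × Finset (Site 2)
      → ℝ, ∀ S r, c S r = if ((↑r.1, ↑r.2.1, ↑S, ↑r.2.2.1, ↑r.2.2.2) : Bits) ∈ crossingEvent R δ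
        then a r else 0 := ⟨_, fun _ _ => rfl⟩
  obtain ⟨G, hG⟩ : ∃ G : ℝ → ℝ, ∀ q, G q = ∑ r ∈ P, ∑ S ∈ K₃.powerset,
      c S r * ∏ i ∈ K₃, weight univ (↑S : Set (Site 2)) i q := ⟨_, fun _ => rfl⟩
  obtain ⟨G', hG'⟩ : ∃ G' : ℝ → ℝ, ∀ q, G' q = ∑ r ∈ P, ∑ S ∈ K₃.powerset,
      c S r * ∑ e ∈ K₃, (∏ j ∈ K₃.erase e, weight univ (↑S : Set (Site 2)) j q) *
        dweight univ (↑S : Set (Site 2)) e := ⟨_, fun _ => rfl⟩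
  have hGd : ∀ q, HasDerivAt G (G' q) q := fun q => by
    rw [hG']
    exact (HasDerivAt.fun_sum (u := P) fun r _ => HasDerivAt.fun_sum (u := K₃.powerset)
      fun (S : Finset (Site 2)) _ => (hasDerivAt_prod_weight K₃ (↑S : Set (Site 2)) q).const_mul
        (c S r)).congr_of_eventuallyEq (Eventually.of_forall hG)
  have hPG : ∀ q ∈ Icc (0:ℝ) 1, gaugeCrossingProb q R δ = G q := fun q hq => by
    simp only [gaugeCrossingProb, hP0 q hq, hG, hc]
  -- Russo: `Σ_{f ∈ K₃} I_f = G'` on `[0, 1]`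
  have hinf : ∀ q ∈ Icc (0:ℝ) 1, ∀ f ∈ K₃, influence q R δ f = ∑ r ∈ P, ∑ S ∈ K₃.powerset,
      c S r * ((∏ j ∈ K₃.erase f, weight univ (↑S : Set (Site 2)) j q) *
        dweight univ (↑S : Set (Site 2)) f) := by
    intro q hq f hf
    rw [influence, hPf f true q hq, hPf f false q hq, ← Finset.sum_sub_distrib]
    refine Finset.sum_congr rfl fun r _ => ?_
    rw [← Finset.sum_sub_distrib, ← sum_pair_weight hf (fun S => c S r) q]
    refine Finset.sum_congr rfl fun S _ => ?_
    rw [force_true_rep, force_false_rep, hc, hc]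
    ring
  have hIG : ∀ q ∈ Icc (0:ℝ) 1, ∑ f ∈ K₃, influence q R δ f = G' q := by
    intro q hq
    rw [hG', Finset.sum_congr rfl (hinf q hq), Finset.sum_comm]
    refine Finset.sum_congr rfl fun r _ => ?_
    rw [Finset.sum_comm]
    refine Finset.sum_congr rfl fun S _ => ?_
    rw [Finset.mul_sum]
  -- faces outside `K₃` have influence `0`: the `finsum` is a finite sum
  have hsum : ∀ q, influenceSum q R δ = ∑ f ∈ K₃, |influence q R δ f| := by
    intro q
    refine finsum_eq_sum_of_support_subset _ fun f hf => ?_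
    rw [Function.mem_support] at hf
    by_contra hfK
    refine hf ?_
    have hfK' : f ∉ K₃ := fun h => hfK (Finset.mem_coe.2 h)
    rw [influence, hfix f hfK' true, hfix f hfK' false, sub_self, abs_zero]
  -- mean value inequality on `[p₁, p₂] ⊆ [0, 1]`
  have hMVT := norm_image_sub_le_of_norm_deriv_le_segment' (f := G) (f' := G') (C := M)
    (a := p₁) (b := p₂) (fun x _ => (hGd x).hasDerivWithinAt) (fun x hx => by
      have hx1 : x ∈ Icc (0:ℝ) 1 := ⟨hp₁.trans hx.1, hx.2.le.trans hp₂⟩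
      rw [← hIG x hx1, Real.norm_eq_abs]
      exact (Finset.abs_sum_le_sum_abs _ _).trans ((hsum x) ▸ hM x hx.1 hx.2.le))
    p₂ ⟨h₁₂, le_rfl⟩
  rw [hPG p₂ ⟨hp₁.trans h₁₂, hp₂⟩, hPG p₁ ⟨hp₁, h₁₂.trans hp₂⟩, ← Real.norm_eq_abs]
  exact hMVT

end Summit.CriticalPhenomena.CardyFormulaZ2.Theorems.CornerLineDescent.SymmetricSeed
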